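import Summits.Ventures.YMGap.RobustBall.RobustStarDoorW
import Summits.Ventures.YMGap.RobustBall.MassGapOnBallZdGRowsSU3Certified
import HarnessLib

/-!
# Venture YMGap, track ROBUST-BALL (Y2) — `SU(3)` CERTIFIED-STAR rows on the TIER-2 (weighted, infinite-range) torus ball
# `ClusterDomain κ ε₀ ε₁` GIVEN H1, H2: ds-2's WEIGHTED robust vertex-star door fed with the certified modulus `K = 7/5`

HONEST FRAMING. WHAT THIS IS: a venture file (cell `pub-ymgap`, track Y2 ROBUST-BALL, seat engine-2 (g8); 0 compute): ds-2 g9's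
«Y2-X2-W» door `RobustStarDoorW.torusClusteringOnBallW_upTo_of_robustStar` / `clusterDomainClusteringW_dim3_of_robustStar` (weighted
Dobrushin–Shlosman window iteration, NO range hypothesis; door `ρ_t = e^t·(R_G^{(d)}(c) + (e^{2t}λ + θ^K·4d·e^{2t}λ)/(1−θ)) < 1` at any rate
`0 ≤ t ≤ κ`) fed (§1) with ANY one-link modulus `OneLinkKRModulus N R K` for every `N ≥ 2` at a weight `t` with `e^t`, `e^{2t}` given in
closed form (every lineage weight `t = log q`, `q ∈ ℚ`), and (§2) with the cell's CERTIFIED `SU(3)` modulus `K = 7/5` (H1 ∧ H2 ⇒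
`OneLinkKRModulus 3 (11/30) (7/5)`, `TorusRowsSU3StarCertified.su3_certifiedModulus_of_pair`) at the lineage weight `t = log 6/5`
(`e^t = 6/5`, `e^{2t} = 36/25` exactly), for every `κ ≥ log 6/5`.  H1 `OneLinkPoincareSUN 3 (3/5) (4/5)` and H2
`OneLinkVarianceBound 3 (11/30) (49/20)` are finite-dimensional, two-engine certified, DISPLAYED AS HYPOTHESES — NOT proved here (class «K × C-iv»).
THIS FILE HAS SCHEMAS ONLY (§0–§2); the NAMED CELLS live in the sibling file `TorusRowsSU3StarCertifiedWCells.lean` (one-parameter ball `(ε₀, ε₁) = (2ε, ε)`, exact rationals, `e^{2ε}` by `Real.exp_bound'`, `√3 ≤ 1.73206`, Neumann depth 20;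
certificates engine-2 `cert_su3_starW.py`): currency `∃ A, ∀ β ∈ [0, β_W/3], TorusClusteringOnBallW 3 4 β κ (2ε) ε A (log 6/5)` (every member of the
tier-2 ball clusters exponentially at rate `log 6/5` on every torus `(ℤ/L)⁴`, `L ≥ 3`, uniformly in `L`, at every tree coupling up to `β_W/3`):
`d = 4`: (1 / 8, .127) (1 / 5, .093) (1 / 4, .074) (1 / 3, .047) (2 / 5, .029) (9 / 20, .016) (1 / 2, .005);
`d = 3` (Y4's receiving currency on the weighted ball `YM3IR.ClusterDomainClustering ⟨ρ₃, β_W/3, ClusterDomain κ (2ε) ε⟩ suFrobDist (log 6/5)` + torus form):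
(1 / 4, .108) (1 / 3, .086) (1 / 2, .050) (3 / 5, .032) (2 / 3, .021) (3 / 4, .008).
WHAT MOVES: the `SU(3)` TIER-2 torus frontier GIVEN H1, H2 was `β_W = 1/5` in `d = 4` and `1/3` in `d = 3` (variance single-link door at weight
`log 6/5`, `TorusRowsSU3Variance` / `TorusRowsSU3YM3`: (1/8, .257) (1/5, .128); (1/4, .181) (1/3, .096)); through the weighted star door it is `1/2`
resp. `3/4` (door thresholds at `ε = 0`: `β_W ≈ .52` / `.80` — here the DOOR binds, not the certificate radius `11/30`).  Below `β_W ≈ 0.27` the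
variance-door cells are larger and stay.  WHAT THIS IS NOT: not hypothesis-free (ds-2's W6 carries the hypothesis-free cells); radii / thresholds
are door artefacts; one-sided clustering bounds on finite tori, not a spectral gap; nothing at weak coupling, nothing about the continuum limit
or the Millennium problem.

## References
* R. L. Dobrushin, S. B. Shlosman (1985); H.-O. Georgii, *Gibbs Measures and Phase Transitions* (2011) Rem. 8.26; H. Föllmer, LNM 1362 (1988)
  Cor. (2.14) (the weighted window iteration, as cited in ds-2's `DobrushinShlosmanWeighted`).
* The tree: `RobustBall/RobustStarDoorW.lean` (ds-2 g9), `TorusRowsSU3StarCertified*.lean`, `MassGapOnBallZdGRowsSU3Certified.lean` (this seat),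
  `Thresholds/StarSU3CertifiedRows.lean` (engine-2 g4), `Thresholds/StarResolventDim.lean` (`gaugeR`, `doorPoly`).
-/

noncomputable section

open Finset
open Literature.MathematicalPhysics.QuantumLattice (fundamentalRep)
open Literature.MathematicalPhysics.QuantumFieldTheory hiding ZdEdge
open Literature.MathematicalPhysics.QuantumFieldTheory.Balaban1983to89.StrongCouplingTorusWindow
open Literature.MathematicalPhysics.QuantumFieldTheory.Balaban1983to89.StrongCouplingDobrushinWindow
  (OneLinkKRModulus)
open Summit.QuantumFields.BalabanUV.InfraRed.StrongCouplingPoincareDoorSUN (OneLinkPoincareSUN)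
open Summit.QuantumFields.BalabanUV.InfraRed.StrongCouplingVarianceDoorSUN (OneLinkVarianceBound)
open Summit.Ventures.YMGap.StarResolventDim (Delta gaugeR doorPoly Delta_pos_of_door gaugeR_lt_one_of_door)

namespace Summit.Ventures.YMGap.RobustBall

/-! ### 0. The lineage weight `log 6/5` in closed form -/

/-- `0 ≤ log (6/5)`. [folklore] -/
theorem log_sixFifths_nonneg : 0 ≤ Real.log (6 / 5) := Real.log_nonneg (by norm_num)

/-- `e^{log (6/5)} = 6/5`. [folklore] -/
theorem exp_log_sixFifths : Real.exp (Real.log (6 / 5)) = 6 / 5 := Real.exp_log (by norm_num)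

/-- `e^{2 log (6/5)} = 36/25`. [folklore] -/
theorem exp_two_mul_log_sixFifths : Real.exp (2 * Real.log (6 / 5)) = 36 / 25 := by
  rw [show (2 : ℝ) * Real.log (6 / 5) = Real.log (6 / 5) + Real.log (6 / 5) by ring, Real.exp_add, exp_log_sixFifths]
  norm_num

/-! ### 1. Generic schemas on the WEIGHTED ball: every `N ≥ 2`, ANY one-link modulus, weight `t` with `e^t`, `e^{2t}` in closed form -/

/-- **SCHEMA, `SU(N)` (`N ≥ 2`), `d = 4`, ANY MODULUS, TIER 2**: torus clustering at rate `t` on the whole weighted ball `ClusterDomain κ ε₀ ε₁`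
(`0 ≤ t ≤ κ`, `e^t = Wt`, `e^{2t} = W2`) up to tree coupling `β_W/N`, through ds-2's weighted robust star door on a modulus `OneLinkKRModulus N R K`
valid at radius `R ≥ 6β_W/N²`; door in exact form `Wt·(gaugeR 4 c + (W2·λ + θ^Kn·16·W2·λ)/(1−θ)) < 1`, `θ = 6c + λ`. [folklore] -/
theorem suN_torusClusteringOnBallW_upTo_star_of_modulus (Kn : ℕ) {N : ℕ} (hN : 2 ≤ N)
    {βW κ ε₀ ε₁ c lam E S R K t Wt W2 : ℝ} (hK : 0 ≤ K) (hmod : OneLinkKRModulus N R K) (hβ0 : 0 ≤ βW)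
    (hR : βW / (N : ℝ) ^ 2 * 6 ≤ R) (hε₁ : 0 ≤ ε₁) (ht : 0 ≤ t) (htκ : t ≤ κ) (hWt : Real.exp t = Wt)
    (hW2 : Real.exp (2 * t) = W2) (hE : Real.exp ε₀ ≤ E) (hS : Real.sqrt N ≤ S)
    (hc : K * E * (1 + 2 * S * ε₁) * (βW / (N : ℝ) ^ 2) ≤ c) (hlam : S * ε₁ ≤ lam) (hθ1 : 6 * c + lam < 1)
    (hcd : doorPoly 4 c < 1)
    (hρ1 : Wt * (gaugeR 4 c + (W2 * lam + (6 * c + lam) ^ Kn * (16 * (W2 * lam))) / (1 - (6 * c + lam))) < 1) :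
    ∃ A : ℝ, ∀ β : ℝ, 0 ≤ β → β ≤ βW / N → TorusClusteringOnBallW N 4 β κ ε₀ ε₁ A t := by
  have hN1 : 1 ≤ N := by omega
  have hNpos : (0 : ℝ) < N := by exact_mod_cast (show 0 < N by omega)
  have hS0 : 0 ≤ S := (Real.sqrt_nonneg _).trans hS
  have hE0 : 0 ≤ E := (Real.exp_pos _).le.trans hE
  have hβN : βW / (N : ℝ) / (N : ℝ) = βW / (N : ℝ) ^ 2 := by rw [div_div, sq]
  have hR' : βW / (N : ℝ) / (N : ℝ) * (2 * (((4 : ℕ) : ℝ) - 1)) ≤ R := by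
    rw [hβN]; refine le_trans (le_of_eq ?_) hR; norm_num
  have hc' : K * Real.exp ε₀ * (1 + 2 * Real.sqrt N * ε₁) * (βW / (N : ℝ) / (N : ℝ)) ≤ c := by
    refine le_trans ?_ hc
    rw [hβN]
    have hb : 0 ≤ βW / (N : ℝ) ^ 2 := by positivity
    have h2 : 1 + 2 * Real.sqrt N * ε₁ ≤ 1 + 2 * S * ε₁ := by nlinarith
    have h3 : 0 ≤ 1 + 2 * Real.sqrt N * ε₁ := by positivity
    calc K * Real.exp ε₀ * (1 + 2 * Real.sqrt N * ε₁) * (βW / (N : ℝ) ^ 2)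
        ≤ K * E * (1 + 2 * Real.sqrt N * ε₁) * (βW / (N : ℝ) ^ 2) := by gcongr
      _ ≤ K * E * (1 + 2 * S * ε₁) * (βW / (N : ℝ) ^ 2) := by gcongr
  have hlam' : Real.sqrt N * ε₁ ≤ lam := le_trans (mul_le_mul_of_nonneg_right hS hε₁) hlam
  have hθ' : 6 * c + lam = (2 * ((4 : ℕ) : ℝ) - 2) * c + lam := by push_cast; ring
  have hρ' : Wt * (gaugeR 4 c + (W2 * lam + (6 * c + lam) ^ Kn * (16 * (W2 * lam))) / (1 - (6 * c + lam))) =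
      Real.exp t * (gaugeR 4 c + (Real.exp (2 * t) * lam + (6 * c + lam) ^ Kn * (4 * ((4 : ℕ) : ℝ) *
        (Real.exp (2 * t) * lam))) / (1 - (6 * c + lam))) := by
    rw [hWt, hW2]; push_cast; ring
  exact ⟨_, torusClusteringOnBallW_upTo_of_robustStar (d := 4) (N := N) (by norm_num) hN1 Kn hK hR' hmod hε₁ ht htκ hc'
    hlam' hθ' hθ1 hcd hρ' (hρ' ▸ hρ1)⟩

/-- **SCHEMA, `SU(N)` (`N ≥ 2`), `d = 3`, ANY MODULUS, TIER 2**: Y4's receiving currency `YM3IR.ClusterDomainClustering` for membership in the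
weighted ball `ClusterDomain κ ε₀ ε₁` up to `β_W/N` at rate `t`, plus the torus form, through ds-2's weighted robust star door on a modulus valid at
radius `R ≥ 4β_W/N²` (door `8c² + 6c < 1`, `θ = 4c + λ`, `Wt·(gaugeR 3 c + (W2·λ + θ^Kn·12·W2·λ)/(1−θ)) < 1`). [folklore] -/
theorem suN_clusterDomainClusteringW_dim3_star_of_modulus (Kn : ℕ) {N : ℕ} (hN : 2 ≤ N)
    {βW κ ε₀ ε₁ c lam E S R K t Wt W2 : ℝ} (hK : 0 ≤ K) (hmod : OneLinkKRModulus N R K) (hβ0 : 0 ≤ βW)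
    (hR : βW / (N : ℝ) ^ 2 * 4 ≤ R) (hε₁ : 0 ≤ ε₁) (ht : 0 ≤ t) (htκ : t ≤ κ) (hWt : Real.exp t = Wt)
    (hW2 : Real.exp (2 * t) = W2) (hE : Real.exp ε₀ ≤ E) (hS : Real.sqrt N ≤ S)
    (hc : K * E * (1 + 2 * S * ε₁) * (βW / (N : ℝ) ^ 2) ≤ c) (hlam : S * ε₁ ≤ lam) (hθ1 : 4 * c + lam < 1)
    (hcd : doorPoly 3 c < 1)
    (hρ1 : Wt * (gaugeR 3 c + (W2 * lam + (4 * c + lam) ^ Kn * (12 * (W2 * lam))) / (1 - (4 * c + lam))) < 1) :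
    YM3IR.ClusterDomainClustering (G := SUN N)
        ⟨fundamentalRep (Fin N), βW / N, fun _ _ W => W ∈ ClusterDomain κ ε₀ ε₁⟩ suFrobDist t ∧
      ∃ A : ℝ, ∀ β : ℝ, 0 ≤ β → β ≤ βW / N → TorusClusteringOnBallW N 3 β κ ε₀ ε₁ A t := by
  have hN1 : 1 ≤ N := by omega
  have hNpos : (0 : ℝ) < N := by exact_mod_cast (show 0 < N by omega)
  have hS0 : 0 ≤ S := (Real.sqrt_nonneg _).trans hS
  have hE0 : 0 ≤ E := (Real.exp_pos _).le.trans hE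
  have hβN : βW / (N : ℝ) / (N : ℝ) = βW / (N : ℝ) ^ 2 := by rw [div_div, sq]
  have hR' : βW / (N : ℝ) / (N : ℝ) * 4 ≤ R := by rw [hβN]; exact hR
  have hR'' : βW / (N : ℝ) / (N : ℝ) * (2 * (((3 : ℕ) : ℝ) - 1)) ≤ R := by
    rw [hβN]; refine le_trans (le_of_eq ?_) hR; norm_num
  have hc' : K * Real.exp ε₀ * (1 + 2 * Real.sqrt N * ε₁) * (βW / (N : ℝ) / (N : ℝ)) ≤ c := by
    refine le_trans ?_ hc
    rw [hβN]
    have hb : 0 ≤ βW / (N : ℝ) ^ 2 := by positivity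
    have h2 : 1 + 2 * Real.sqrt N * ε₁ ≤ 1 + 2 * S * ε₁ := by nlinarith
    have h3 : 0 ≤ 1 + 2 * Real.sqrt N * ε₁ := by positivity
    calc K * Real.exp ε₀ * (1 + 2 * Real.sqrt N * ε₁) * (βW / (N : ℝ) ^ 2)
        ≤ K * E * (1 + 2 * Real.sqrt N * ε₁) * (βW / (N : ℝ) ^ 2) := by gcongr
      _ ≤ K * E * (1 + 2 * S * ε₁) * (βW / (N : ℝ) ^ 2) := by gcongr
  have hlam' : Real.sqrt N * ε₁ ≤ lam := le_trans (mul_le_mul_of_nonneg_right hS hε₁) hlam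
  have hθ3 : 4 * c + lam = (2 * ((3 : ℕ) : ℝ) - 2) * c + lam := by push_cast; ring
  have hρ3 : Wt * (gaugeR 3 c + (W2 * lam + (4 * c + lam) ^ Kn * (12 * (W2 * lam))) / (1 - (4 * c + lam))) =
      Real.exp t * (gaugeR 3 c + (Real.exp (2 * t) * lam + (4 * c + lam) ^ Kn * (12 *
        (Real.exp (2 * t) * lam))) / (1 - (4 * c + lam))) := by
    rw [hWt, hW2]
  have hρ3' : Wt * (gaugeR 3 c + (W2 * lam + (4 * c + lam) ^ Kn * (12 * (W2 * lam))) / (1 - (4 * c + lam))) =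
      Real.exp t * (gaugeR 3 c + (Real.exp (2 * t) * lam + (4 * c + lam) ^ Kn * (4 * ((3 : ℕ) : ℝ) *
        (Real.exp (2 * t) * lam))) / (1 - (4 * c + lam))) := by
    rw [hWt, hW2]; push_cast; ring
  refine ⟨clusterDomainClusteringW_dim3_of_robustStar (N := N) hN1 Kn hK hR' hmod hε₁ ht htκ hc' hlam' rfl hθ1 hcd hρ3
      (hρ3 ▸ hρ1), _, torusClusteringOnBallW_upTo_of_robustStar (d := 3) (N := N) (by norm_num) hN1 Kn hK hR'' hmod hε₁ ht
      htκ hc' hlam' hθ3 hθ1 hcd hρ3' (hρ3' ▸ hρ1)⟩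

/-! ### 2. The `SU(3)` schemas GIVEN H1, H2 at the lineage weight `t = log 6/5` (every `κ ≥ log 6/5`) -/

/-- **SCHEMA, `SU(3)`, `d = 4`, TIER 2, GIVEN H1, H2**: for `0 ≤ β_W ≤ 11/20`, `κ ≥ log 6/5`, majorant `e^{ε₀} ≤ E`,
`c ≥ (7/5)·E·(1 + 2·1.73206·ε₁)·β_W/9`, `λ ≥ 1.73206·ε₁` and the rational door `(6/5)·(gaugeR 4 c + ((36/25)λ + θ^Kn·16·(36/25)λ)/(1−θ)) < 1`:
`∃ A, ∀ β ∈ [0, β_W/3], TorusClusteringOnBallW 3 4 β κ ε₀ ε₁ A (log 6/5)`. [folklore] -/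
theorem su3_torusClusteringOnBallW_upTo_certifiedStar (Kn : ℕ) (hP : OneLinkPoincareSUN 3 (3 / 5) (4 / 5))
    (hV : OneLinkVarianceBound 3 (11 / 30) (49 / 20)) {βW κ ε₀ ε₁ c lam E : ℝ} (hβ0 : 0 ≤ βW) (hβ : βW ≤ 11 / 20)
    (hκ : Real.log (6 / 5) ≤ κ) (hε₁ : 0 ≤ ε₁) (hE : Real.exp ε₀ ≤ E) (hc : 7 / 5 * E * (1 + 2 * 1.73206 * ε₁) * (βW / 9) ≤ c)
    (hlam : 1.73206 * ε₁ ≤ lam) (hθ1 : 6 * c + lam < 1) (hcd : doorPoly 4 c < 1)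
    (hρ1 : 6 / 5 * (gaugeR 4 c + (36 / 25 * lam + (6 * c + lam) ^ Kn * (16 * (36 / 25 * lam))) / (1 - (6 * c + lam))) < 1) :
    ∃ A : ℝ, ∀ β : ℝ, 0 ≤ β → β ≤ βW / 3 → TorusClusteringOnBallW 3 4 β κ ε₀ ε₁ A (Real.log (6 / 5)) := by
  have hS : Real.sqrt ((3 : ℕ) : ℝ) ≤ 1.73206 := by
    have : ((3 : ℕ) : ℝ) = 3 := by norm_num
    rw [this]; exact sqrt_three_le
  have e9 : βW / ((3 : ℕ) : ℝ) ^ 2 = βW / 9 := by norm_num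
  have e3 : βW / ((3 : ℕ) : ℝ) = βW / 3 := by norm_num
  have hR : βW / ((3 : ℕ) : ℝ) ^ 2 * 6 ≤ 11 / 30 := by rw [e9]; linarith
  have hc' : 7 / 5 * E * (1 + 2 * 1.73206 * ε₁) * (βW / ((3 : ℕ) : ℝ) ^ 2) ≤ c := by rw [e9]; exact hc
  have h := suN_torusClusteringOnBallW_upTo_star_of_modulus Kn (N := 3) (by norm_num) (by norm_num)
    (su3_certifiedModulus_of_pair hP hV) hβ0 hR hε₁ log_sixFifths_nonneg hκ exp_log_sixFifths exp_two_mul_log_sixFifths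
    hE hS hc' hlam hθ1 hcd hρ1
  rw [e3] at h
  exact h

/-- **SCHEMA, `SU(3)`, `d = 3`, TIER 2, GIVEN H1, H2**: for `0 ≤ β_W ≤ 33/40`, `κ ≥ log 6/5`, the `d = 3` door
`(6/5)·(gaugeR 3 c + ((36/25)λ + θ^Kn·12·(36/25)λ)/(1−θ)) < 1` (`θ = 4c + λ`, `8c² + 6c < 1`): Y4's `ClusterDomainClustering` on the weighted
ball up to `β_W/3` at rate `log 6/5`, plus the torus form. [folklore] -/
theorem su3_clusterDomainClusteringW_dim3_certifiedStar (Kn : ℕ) (hP : OneLinkPoincareSUN 3 (3 / 5) (4 / 5))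
    (hV : OneLinkVarianceBound 3 (11 / 30) (49 / 20)) {βW κ ε₀ ε₁ c lam E : ℝ} (hβ0 : 0 ≤ βW) (hβ : βW ≤ 33 / 40)
    (hκ : Real.log (6 / 5) ≤ κ) (hε₁ : 0 ≤ ε₁) (hE : Real.exp ε₀ ≤ E) (hc : 7 / 5 * E * (1 + 2 * 1.73206 * ε₁) * (βW / 9) ≤ c)
    (hlam : 1.73206 * ε₁ ≤ lam) (hθ1 : 4 * c + lam < 1) (hcd : doorPoly 3 c < 1)
    (hρ1 : 6 / 5 * (gaugeR 3 c + (36 / 25 * lam + (4 * c + lam) ^ Kn * (12 * (36 / 25 * lam))) / (1 - (4 * c + lam))) < 1) :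
    YM3IR.ClusterDomainClustering (G := SUN 3)
        ⟨fundamentalRep (Fin 3), βW / 3, fun _ _ W => W ∈ ClusterDomain κ ε₀ ε₁⟩ suFrobDist (Real.log (6 / 5)) ∧
      ∃ A : ℝ, ∀ β : ℝ, 0 ≤ β → β ≤ βW / 3 → TorusClusteringOnBallW 3 3 β κ ε₀ ε₁ A (Real.log (6 / 5)) := by
  have hS : Real.sqrt ((3 : ℕ) : ℝ) ≤ 1.73206 := by
    have : ((3 : ℕ) : ℝ) = 3 := by norm_num
    rw [this]; exact sqrt_three_le
  have e9 : βW / ((3 : ℕ) : ℝ) ^ 2 = βW / 9 := by norm_num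
  have e3 : βW / ((3 : ℕ) : ℝ) = βW / 3 := by norm_num
  have hR : βW / ((3 : ℕ) : ℝ) ^ 2 * 4 ≤ 11 / 30 := by rw [e9]; linarith
  have hc' : 7 / 5 * E * (1 + 2 * 1.73206 * ε₁) * (βW / ((3 : ℕ) : ℝ) ^ 2) ≤ c := by rw [e9]; exact hc
  have h := suN_clusterDomainClusteringW_dim3_star_of_modulus Kn (N := 3) (by norm_num) (by norm_num)
    (su3_certifiedModulus_of_pair hP hV) hβ0 hR hε₁ log_sixFifths_nonneg hκ exp_log_sixFifths exp_two_mul_log_sixFifths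
    hE hS hc' hlam hθ1 hcd hρ1
  rw [e3] at h
  exact h

end Summit.Ventures.YMGap.RobustBall

end
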